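import Mathlib
import Literature.MathematicalPhysics.QuantumFieldTheory.Balaban1983to89.B14Sect1Repr

/-!
# `Balaban1983to89.B14Eq12Locality` — T. Bałaban, *Convergent renormalization expansions for lattice gauge theories*,
# Commun. Math. Phys. **119** (1988) 243–285 [Balaban1988Convergent]: the sentence after (1.2)/(1.3) p. 246, *"The function
# in (1.2) depends on the field V restricted to □′^{∼4}"* (`B14.Sect1Repr.U1locDependsOn`), PROVED from the three
# localities it is made of

statement-level skeleton of published theorems with citation tags; proofs where landed; nothing here is a claim about the Yang–Mills mass gap

PDF held: `paper:balaban1988-cmp119-convergent-renormalization` (journal page = PDF page + 242); p. 246 read on the x2 render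
`…-p004-x2.png` of `run/shared/lean/pub/pub-balaban/b2b-balaban-ref1/pages/1988-cmp119-convergent-renormalization/`.

CITATION HEADER (lean-in-tree rule).  WHAT IS REPRODUCED, verbatim, p. 246 [PDF 4]: *"U_{1,□′}(V) = U(𝐁₁(□′^{∼4}),
M˙(Q₁^{s*}V)), (1.2) where 𝐁₁(□′^{∼4}) is the minimal determining set based on □′^{∼4}, and Q₁^{s*}V was introduced in
(4.5.3) [18] … The function in (1.2) depends on the field V restricted to □′^{∼4}."* — SKELETON row **B14.Eq1.2**, typed
by `B14Sect1Repr` (p243633) as the DEFINITION `B14.Sect1Repr.U1loc` over the abstract `Sect1Data` carrier with the quoted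
sentence as the `Prop` `U1locDependsOn` (*"typed as Prop, not proved"* in ROWS-B14 ≤ v1.18).

THE ARGUMENT (why the sentence is "obvious" in print, made explicit).  `U_{1,□′}(V)` is the composite of three maps, each
local: (a) the minimal configuration `U(𝐁, β)` of [15] is a function of the data `β` ON the determining set `𝐁` only —
by definition of the variational problem (2.12) whose constraint reads `M_𝐁(U) = β` on `𝐁` (`hU`); (b) the averaging
`M˙` is local: the data of `M˙(U)` on `𝐁₁(□′^{∼4})` are determined by `U` on the fine bonds of the region `□′^{∼4}`
(`Setup.Averaging.local_dep` for each `M^j`; `hM`); (c) `Q₁^{s*}V` on that region is determined by `V` on the bonds of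
`□′^{∼4}` ((4.5.3) of [18]: a block-local surface average; `hQ`).  The theorem `u1locDependsOn_of_local` composes the
three; the localities are explicit hypotheses on the abstract `Sect1Data` fields (the carrier does not fix `Umap`, `Mdot`,
`Qsstar`), which is exactly the content the sentence takes from [15]/[18].

Mega-formalization `lit-balaban`, unit `lit-balaban-r11` gen 4 (B14 fold owner; the «not proved» clause of row B14.Eq1.2),
HOME `run/shared/lean/pub/lit-balaban/`.

## References
* [Balaban1988Convergent] T. Bałaban, Commun. Math. Phys. 119 (1988) 243–285, (1.2)–(1.3) p. 246.
* [Balaban1985Variational] T. Bałaban, Commun. Math. Phys. 102 (1985) 277–309 ([15]: the minimal configurations `U(𝐁, ·)`).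
* [BalabanImbrieJaffe1985] T. Bałaban, J. Imbrie, A. Jaffe, Commun. Math. Phys. 97 (1985) 299–329, (4.5.3) ([18]: `Q^{s*}`).
-/

namespace Literature.MathematicalPhysics.QuantumFieldTheory.Balaban1983to89.B14.Eq12Locality

open Literature.MathematicalPhysics.QuantumFieldTheory.Balaban1983to89
open Literature.MathematicalPhysics.QuantumFieldTheory.Balaban1983to89.B14.Sect1Repr

variable {P : Params} {G : Type*} [GaugeGroup G]

/-- **p. 246, the sentence after (1.2), PROVED from its three localities**: if (a) the minimal-configuration map `U(𝐁, β)`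
depends on the data `β` through its restriction to `𝐁` only (`agree 𝐁 β β′ ⇒ U(𝐁, β) = U(𝐁, β′)`), (b) the averaging `M˙`
produces data agreeing on `𝐁₁(□′^{∼4})` from fine fields agreeing on the fine bonds `fine □′` of `□′^{∼4}`, and (c)
`Q₁^{s*}V` on `fine □′` is determined by `V` on the `T^{(1)}`-bonds `vars □′` of `□′^{∼4}`, then *"the function in (1.2)
depends on the field V restricted to □′^{∼4}"* (`U1locDependsOn D vars`). [cite: Balaban1988Convergent, (1.2) p.246] -/
theorem u1locDependsOn_of_local (D : Sect1Data P G) (vars : D.Cube1 → Set (PBond P 1))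
    (fine : D.Cube1 → Set (PBond P 0)) (agree : D.DetSet → D.BData → D.BData → Prop)
    (hU : ∀ (S : D.DetSet) (β β' : D.BData), agree S β β' → D.Umap S β = D.Umap S β')
    (hM : ∀ (c : D.Cube1) (U U' : GaugeField P 0 G),
      (∀ b ∈ fine c, U b = U' b) → agree (D.B1enl4 c) (D.Mdot U) (D.Mdot U'))
    (hQ : ∀ (c : D.Cube1) (V W : GaugeField P 1 G),
      (∀ b ∈ vars c, V b = W b) → ∀ b ∈ fine c, D.Qsstar V b = D.Qsstar W b) :
    U1locDependsOn D vars := by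
  intro c V W hVW
  unfold U1loc
  exact hU _ _ _ (hM c _ _ (hQ c V W hVW))

/-- The same with the locality (a) in the strongest form — `U(𝐁, β)` LITERALLY a function of the restriction of `β` to
`𝐁` (`Umap S β = Usol S (restrict S β)`), as in r12's concrete determining-set calculus (`B15DeterminingSets.DetBackground`):
then agreement = equality of restrictions. [cite: Balaban1988Convergent, (1.2) p.246] -/
theorem u1locDependsOn_of_restrict (D : Sect1Data P G) (vars : D.Cube1 → Set (PBond P 1))
    (fine : D.Cube1 → Set (PBond P 0)) {R : Type*} (restrict : D.DetSet → D.BData → R)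
    (Usol : D.DetSet → R → GaugeField P 0 G) (hU : ∀ S β, D.Umap S β = Usol S (restrict S β))
    (hM : ∀ (c : D.Cube1) (U U' : GaugeField P 0 G),
      (∀ b ∈ fine c, U b = U' b) → restrict (D.B1enl4 c) (D.Mdot U) = restrict (D.B1enl4 c) (D.Mdot U'))
    (hQ : ∀ (c : D.Cube1) (V W : GaugeField P 1 G),
      (∀ b ∈ vars c, V b = W b) → ∀ b ∈ fine c, D.Qsstar V b = D.Qsstar W b) :
    U1locDependsOn D vars :=
  u1locDependsOn_of_local D vars fine (fun S β β' => restrict S β = restrict S β')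
    (fun S β β' h => by rw [hU, hU, h]) hM hQ

/-- Consequence used on p. 246–247 (the localized characteristic functions of (1.4) depend on `V↾□′^{∼4}`): any function
of `U_{1,□′}(V)` — e.g. `χ({sup_{p⊂□′^∼}|U_{1,□′}(V)(∂p) − 1| < ε₁L⁻²})` — depends on `V` through `V↾□′^{∼4}` only.
[cite: Balaban1988Convergent, (1.4) p.246] -/
theorem comp_dependsOn {D : Sect1Data P G} {vars : D.Cube1 → Set (PBond P 1)} (h : U1locDependsOn D vars)
    {α : Type*} (φ : GaugeField P 0 G → α) (c : D.Cube1) (V W : GaugeField P 1 G) (hVW : ∀ b ∈ vars c, V b = W b) :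
    φ (U1loc D c V) = φ (U1loc D c W) := by
  rw [h c V W hVW]

end Literature.MathematicalPhysics.QuantumFieldTheory.Balaban1983to89.B14.Eq12Locality
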